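import Summits.CriticalPhenomena.PercolationContinuityZ3.Theorems.PercNearOneGluingNoHeavyQuantBlockCombMergeModel
import Summits.CriticalPhenomena.PercolationContinuityZ3.Theorems.PercNearOneGluingNoHeavyQuantFarTreeLevelBounds
import Summits.CriticalPhenomena.PercolationContinuityZ3.Theorems.PercNearOneGluingNoHeavyQuantIndepBlobMoments
import HarnessLib

/-!
# QUANT lane R8, FAR on trees: the SECOND-MOMENT (Cantelli) row for block-combs at a fixed depth

builds on p205010 (kernel theorem, internal audit signed; external expert review pending)

Support file (`--supports stmt-CriticalPhenomena-4575`), QUANT lane seat prim-quant-census-2 (gen 48); memo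
`run/shared/lean/prim/quant/prim-quant-census-2-g48/TIED-PLUS-TWO-G48.md` §5.  Theorems only (local notation, no definitions), no sorries, standard axioms.
Model/notation: `…QuantBlockCombMergeModel.lean`; tools: `pd_tail_sum` (p1 g8), `Quant.bernoulliWeight_cantelli` (`…FarTreeLevelBounds`) and the exact moments
`IndepBlob.sum_bernoulliWeight_mul_count` / `sum_bernoulliWeight_mul_sq_sub` (`…IndepBlobMoments`).

WHY.  After `…QuantBlockCombTiedPlusTwo` (FAR for every block-comb all-tied except two blocks) the reduction scheme {giant, merges, class, witness,
delete + contract, root split, affine slide} reduces the general block-comb far-relay row to its corner 'non-mergeable tied root blob + k ≥ 3 carriers', and the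
scheme-irreducible instances found there (LEAD-NOTES-G13 N24 (4)'s harmonic staircase; memo §5: 26 unit carriers just under the no-merge profile, x = 0.01, j = 3,
TAIL = 88·x) are CONCENTRATION-easy: at the root μ₀ = 5.99 > j, σ₀² = 4.55, and Cantelli alone gives TAIL ≥ 0.66.  This file puts that row in the canonical vocabulary.

* `Quant.BlockComb.tail_ge_prefixProd_mul_level` — for every depth `l ≤ D`: `(∏_{i<l} q i)·Φ_l ≤ TAIL`, where `Φ_l = Σ_S wt S·𝟙[j+1 ≤ mass_l S]` is the probability
  that the blobs at levels `≤ l` alone cross (chain open to depth `≥ l` has probability `∏_{i<l} q i = Σ_{i ≥ l} pd i`, and the crossing indicator is monotone in the depth).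
* `Quant.BlockComb.levelCross_eq_one_sub` — `Φ_l = 1 − Σ_{S : mass_l S ≤ j} wt S`.
* `Quant.BlockComb.tail_ge_cantelli_level` — **Cantelli row at depth `l`.**  With `μ = Σ_{lv k ≤ l} a k·g k` and `V = Σ_{lv k ≤ l} (a k)²·g k(1 − g k)` (mean and
  variance of the level-`l` mass), if `j < μ` then `(∏_{i<l} q i)·(1 − V/(V + (μ − j)²)) ≤ TAIL`.
[this work]
-/

namespace Summit.CriticalPhenomena.PercolationContinuityZ3.Theorems

namespace Quant

namespace BlockComb

open Finset

variable {κ : Type*} [Fintype κ] [DecidableEq κ]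

/-- product-Bernoulli weight of the set `S` of open blob gates -/
local notation3 "wt[" g ", " S "]" => ∏ k, (if k ∈ (S : Finset κ) then (g : κ → ℝ) k else 1 - (g : κ → ℝ) k)

/-- probability that the chain `q` of length `D` is open exactly to depth `i` -/
local notation3 "pd[" D ", " q ", " i "]" =>
  (∏ i' ∈ Finset.range (i : ℕ), (q : ℕ → ℝ) i') * (if (i : ℕ) < (D : ℕ) then 1 - (q : ℕ → ℝ) i else 1)

/-- mass counted at depth `i` in blob configuration `S` -/
local notation3 "mass[" lv ", " a ", " i ", " S "]" =>
  ∑ k ∈ (S : Finset κ).filter (fun k => (lv : κ → ℕ) k ≤ (i : ℕ)), ((a : κ → ℕ) k : ℕ)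

/-- the tail `P(N ≥ j+1)` of the block-comb count, as an explicit finite sum -/
local notation3 "TAIL[" D ", " q ", " lv ", " a ", " g ", " j "]" =>
  ∑ i ∈ Finset.range ((D : ℕ) + 1), pd[D, q, i] *
    ∑ S : Finset κ, wt[g, S] * (if (j : ℕ) + 1 ≤ mass[lv, a, i, S] then (1 : ℝ) else 0)

/-- the level-`l` crossing probability `Φ_l = Σ_S wt S·𝟙[j+1 ≤ mass_l S]` (blobs at levels `≤ l` alone cross) -/
local notation3 "CROSS[" lv ", " a ", " g ", " j ", " l "]" =>
  ∑ S : Finset κ, wt[g, S] * (if (j : ℕ) + 1 ≤ mass[lv, a, l, S] then (1 : ℝ) else 0)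

/-! ### 1. The tail dominates `W_l · Φ_l` at every depth -/

omit [Fintype κ] [DecidableEq κ] in
/-- The mass counted at depth `i` is non-decreasing in the depth. [folklore] -/
theorem mass_mono_depth (lv : κ → ℕ) (a : κ → ℕ) {l i : ℕ} (hli : l ≤ i) (S : Finset κ) :
    mass[lv, a, l, S] ≤ mass[lv, a, i, S] := by
  refine Finset.sum_le_sum_of_subset fun k hk => ?_
  rw [Finset.mem_filter] at hk ⊢
  exact ⟨hk.1, hk.2.trans hli⟩

/-- The level crossing probability is nonnegative. [folklore] -/
theorem levelCross_nonneg (lv : κ → ℕ) (a : κ → ℕ) (g : κ → ℝ) (hg : ∀ k, 0 ≤ g k ∧ g k ≤ 1) (j l : ℕ) :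
    0 ≤ CROSS[lv, a, g, j, l] :=
  Finset.sum_nonneg fun S _ => mul_nonneg (wt_nonneg g hg S) (by split_ifs <;> norm_num)

/-- **The tail dominates `(∏_{i<l} q i)·Φ_l`** for every depth `l ≤ D`: the chain is open to depth `≥ l` with probability `∏_{i<l} q i = Σ_{i≥l} pd i`
(`pd_tail_sum`) and on that event the blobs at levels `≤ l` alone may cross. [this work] -/
theorem tail_ge_prefixProd_mul_level (D : ℕ) (q : ℕ → ℝ) (hq : ∀ i, 0 ≤ q i ∧ q i ≤ 1) (lv : κ → ℕ) (a : κ → ℕ)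
    (g : κ → ℝ) (hg : ∀ k, 0 ≤ g k ∧ g k ≤ 1) (j l : ℕ) (hlD : l ≤ D) :
    (∏ i ∈ Finset.range l, q i) * CROSS[lv, a, g, j, l] ≤ TAIL[D, q, lv, a, g, j] := by
  have hinner : ∀ i ∈ Finset.range (D + 1),
      (if l ≤ i then CROSS[lv, a, g, j, l] else 0) ≤
        ∑ S : Finset κ, wt[g, S] * (if j + 1 ≤ mass[lv, a, i, S] then (1 : ℝ) else 0) := by
    intro i _
    by_cases hi : l ≤ i
    · rw [if_pos hi]
      refine Finset.sum_le_sum fun S _ => mul_le_mul_of_nonneg_left ?_ (wt_nonneg g hg S)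
      by_cases hS : j + 1 ≤ mass[lv, a, l, S]
      · rw [if_pos hS, if_pos (hS.trans (mass_mono_depth lv a hi S))]
      · rw [if_neg hS]; split_ifs <;> norm_num
    · rw [if_neg hi]
      exact Finset.sum_nonneg fun S _ => mul_nonneg (wt_nonneg g hg S) (by split_ifs <;> norm_num)
  calc (∏ i ∈ Finset.range l, q i) * CROSS[lv, a, g, j, l]
      = (∑ i ∈ (Finset.range (D + 1)).filter (fun i => l ≤ i), pd[D, q, i]) * CROSS[lv, a, g, j, l] := by
        rw [pd_tail_sum q D l hlD]
    _ = ∑ i ∈ Finset.range (D + 1), pd[D, q, i] * (if l ≤ i then CROSS[lv, a, g, j, l] else 0) := by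
        rw [Finset.sum_filter, Finset.sum_mul]
        refine Finset.sum_congr rfl fun i _ => ?_
        by_cases hi : l ≤ i
        · rw [if_pos hi, if_pos hi]
        · rw [if_neg hi, if_neg hi, zero_mul, mul_zero]
    _ ≤ TAIL[D, q, lv, a, g, j] :=
        Finset.sum_le_sum fun i hi => mul_le_mul_of_nonneg_left (hinner i hi) (pd_nonneg D q hq i)

/-! ### 2. The Cantelli row at a fixed depth -/

/-- `Φ_l = 1 − P(mass_l ≤ j)`: the complementary event, against the total weight `Σ_S wt S = 1`. [folklore] -/
theorem levelCross_eq_one_sub (lv : κ → ℕ) (a : κ → ℕ) (g : κ → ℝ) (j l : ℕ) :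
    CROSS[lv, a, g, j, l] =
      1 - ∑ S ∈ (Finset.univ : Finset (Finset κ)).filter (fun S => mass[lv, a, l, S] ≤ j), wt[g, S] := by
  have htot : ∑ S : Finset κ, wt[g, S] = 1 := IndepBlob.sum_bernoulliWeight g
  have hsplit : ∀ S : Finset κ, wt[g, S] * (if j + 1 ≤ mass[lv, a, l, S] then (1 : ℝ) else 0) =
      wt[g, S] - wt[g, S] * (if mass[lv, a, l, S] ≤ j then (1 : ℝ) else 0) := by
    intro S
    by_cases h : j + 1 ≤ mass[lv, a, l, S]
    · rw [if_pos h, if_neg (by omega)]; ring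
    · rw [if_neg h, if_pos (by omega)]; ring
  have h3 : ∑ S : Finset κ, wt[g, S] * (if mass[lv, a, l, S] ≤ j then (1 : ℝ) else 0) =
      ∑ S ∈ (Finset.univ : Finset (Finset κ)).filter (fun S => mass[lv, a, l, S] ≤ j), wt[g, S] := by
    rw [Finset.sum_filter]
    exact Finset.sum_congr rfl fun S _ => by split_ifs <;> simp
  rw [Finset.sum_congr rfl fun S _ => hsplit S, Finset.sum_sub_distrib, htot, h3]

omit [Fintype κ] [DecidableEq κ] in
/-- The level-`l` mass of a configuration, as a real number, is the weighted count with weights `a k·𝟙[lv k ≤ l]`. [folklore] -/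
theorem cast_mass_eq_sum (lv : κ → ℕ) (a : κ → ℕ) (l : ℕ) (S : Finset κ) :
    ((mass[lv, a, l, S] : ℕ) : ℝ) = ∑ k ∈ S, (if lv k ≤ l then (a k : ℝ) else 0) := by
  push_cast
  rw [Finset.sum_filter]

/-- **Cantelli row at depth `l` (canonical block-comb model).**  Chain gates and private gates in `[0,1]`, `l ≤ D`; let
`μ = Σ_k 𝟙[lv k ≤ l]·a k·g k` and `V = Σ_k 𝟙[lv k ≤ l]·(a k)²·g k·(1 − g k)` be the mean and the variance of the mass counted at depth `l`.
If `j < μ` then `(∏_{i<l} q i)·(1 − V/(V + (μ − j)²)) ≤ TAIL`: the chain reaches depth `l` with probability `∏_{i<l} q i`, and there Cantelli's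
inequality bounds `P(mass_l ≤ j) ≤ V/(V + (μ − j)²)`. [this work] -/
theorem tail_ge_cantelli_level (D : ℕ) (q : ℕ → ℝ) (hq : ∀ i, 0 ≤ q i ∧ q i ≤ 1) (lv : κ → ℕ) (a : κ → ℕ)
    (g : κ → ℝ) (hg : ∀ k, 0 ≤ g k ∧ g k ≤ 1) (j l : ℕ) (hlD : l ≤ D) (μ V : ℝ)
    (hμ : μ = ∑ k, (if lv k ≤ l then (a k : ℝ) else 0) * g k)
    (hV : V = ∑ k, (if lv k ≤ l then (a k : ℝ) else 0) ^ 2 * g k * (1 - g k))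
    (hj : (j : ℝ) < μ) :
    (∏ i ∈ Finset.range l, q i) * (1 - V / (V + (μ - j) ^ 2)) ≤ TAIL[D, q, lv, a, g, j] := by
  -- the level-`l` mass as a weighted count
  set a' : κ → ℝ := fun k => if lv k ≤ l then (a k : ℝ) else 0 with ha'
  set f : Finset κ → ℝ := fun S => ∑ k ∈ S, a' k with hf
  have hfmass : ∀ S : Finset κ, f S = ((mass[lv, a, l, S] : ℕ) : ℝ) := fun S => by
    rw [hf, cast_mass_eq_sum lv a l S]
  -- exact first two moments
  have hm : ∑ S : Finset κ, wt[g, S] * f S = μ := by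
    rw [hμ]
    exact IndepBlob.sum_bernoulliWeight_mul_count g a'
  have hvar : ∑ S : Finset κ, wt[g, S] * (f S - μ) ^ 2 = V := by
    have h := IndepBlob.sum_bernoulliWeight_mul_sq_sub g a' μ
    have h2 : ∀ S : Finset κ, wt[g, S] * (f S - μ) ^ 2 = wt[g, S] * (μ - ∑ k ∈ S, a' k) ^ 2 := fun S => by
      rw [hf]; ring
    rw [Finset.sum_congr rfl fun S _ => h2 S, h, ← hμ, sub_self, zero_pow two_ne_zero, zero_add, hV]
  -- Cantelli for the light event `{f ≤ j}`
  have hcant := bernoulliWeight_cantelli g (fun k => (hg k).1) (fun k => (hg k).2) f μ V (j : ℝ) hm hvar hj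
  -- `{f S ≤ j} = {mass_l S ≤ j}`
  have hset : (Finset.univ : Finset (Finset κ)).filter (fun S => f S ≤ (j : ℝ)) =
      (Finset.univ : Finset (Finset κ)).filter (fun S => mass[lv, a, l, S] ≤ j) := by
    ext S
    simp only [Finset.mem_filter, Finset.mem_univ, true_and, hfmass S]
    exact_mod_cast Iff.rfl
  rw [hset] at hcant
  -- assemble
  have hcross : 1 - V / (V + (μ - j) ^ 2) ≤ CROSS[lv, a, g, j, l] := by
    rw [levelCross_eq_one_sub lv a g j l]
    linarith
  have hP : 0 ≤ ∏ i ∈ Finset.range l, q i := Finset.prod_nonneg fun i _ => (hq i).1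
  exact (mul_le_mul_of_nonneg_left hcross hP).trans (tail_ge_prefixProd_mul_level D q hq lv a g hg j l hlD)

end BlockComb

end Quant

end Summit.CriticalPhenomena.PercolationContinuityZ3.Theorems
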